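import Mathlib.Algebra.BigOperators.Group.Finset.Sigma
import Mathlib.Algebra.BigOperators.Ring.Finset
import Mathlib.Algebra.Order.BigOperators.Group.Finset
import Mathlib.Data.Finset.Powerset
import Mathlib.Data.Finset.Max
import Mathlib.Data.Real.Basic
import Mathlib.Tactic.Ring
import HarnessLib

/-!
# Connected (cumulant) multi-point correlations by the anchored moment–cumulant recursion

Topic `Literature/Probability/Moments`. The *connected* `m`-point correlation (joint cumulant)
`G_c(S)` of commuting observables `(n_i)_{i ∈ S}` is defined from the joint moments
`μ(T) = ⟨∏_{i∈T} n_i⟩` by the cluster (moment–cumulant) relation "moment = sum over set partitions of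
products of connected parts" [cite: Kardar2007, §2.2 eq. (2.12) and §2.3 eqs. (2.39)–(2.40)].
Grouping the partitions by the block containing a fixed ANCHOR `a ∈ S` turns that relation into the
recursion
`μ(S) = Σ_{a ∈ T ⊆ S} G_c(T) · μ(S ∖ T)`, i.e. `G_c(S) = μ(S) − Σ_{a ∈ T ⊊ S} G_c(T) μ(S ∖ T)`,
which is the "recursive formula of the multi-point density correlation function" used to extract
`G_c^m` up to order 14 from quantum-gas-microscope samples [cite: ZhengEtAl2026, eq. (3) and
App. F.4 eq. (F7)] (pub-qadeq lane, CLAIMS E-50 / S-18; HONEST FRAMING: instance-level adjudication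
of specific advantage claims; no claim about BQP vs BPP or the summit — this file only types the
ESTIMATOR and its defining property).

## Contents (all proved, 0 named facts)

* `connCorr μ S` — the connected correlation of the sites in the finite set `S`, defined from an
  arbitrary moment function `μ : Finset ι → ℝ` by the recursion above, anchored at `S.min'`
  (well-founded on `S.card`).
* `connCorr_of_nonempty` (the recursion as an equation), `moment_eq_sum_connCorr` (the cluster
  relation in anchored form, `μ(S) = Σ_{T' ⊆ S∖{a}} G_c({a} ∪ T') μ(rest)` when `μ(∅) = 1`),
  `connCorr_empty`, `connCorr_singleton` (`G_c({i}) = μ({i})`), `connCorr_pair`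
  (`G_c({i,j}) = μ({i,j}) − μ({i}) μ({j})`, the covariance), `connCorr_triple` (the third joint
  cumulant `μ_{ijk} − μ_i μ_{jk} − μ_j μ_{ik} − μ_k μ_{ij} + 2 μ_i μ_j μ_k`).
* `connCorr_eq_zero_of_prod` — **connectedness**: if the moments FACTORISE over sites,
  `μ(T) = ∏_{i∈T} m_i` for all `T ⊆ S` (a product / uncorrelated state), then `G_c(S) = 0` for every
  `S` with at least two sites [cite: Kardar2007, §2.3 (cross cumulants of independent variables
  vanish, text after eq. (2.48))]. This is the property that makes `G_c^m` a witness of genuinely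
  `m`-body correlations in [cite: ZhengEtAl2026, App. F.4].
* `moment w n` — the moment function `T ↦ Σ_ω w(ω) ∏_{i∈T} n_i(ω)` of observables on a finite
  weighted sample space, and `moment_prod_indep`: for a product weight on a product space the
  moments of single-site observables factorise (so `connCorr_eq_zero_of_prod` applies).

* **Anchor independence / symmetry** (all proved): `anchoredSum` (the subtracted cluster sum at
  an arbitrary anchor), `anchoredSum_eq_anchoredSum` (it is the same for every anchor `a ∈ S` —
  strong induction on `S` plus the exchanges `T ↦ S ∖ T`, `(T, U) ↦ (U, T)`; no set partitions),
  `connCorr_eq_of_mem` (the recursion holds at EVERY anchor), `moment_eq_sum_connCorr_of_mem`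
  (the cluster relation at every anchor), `connCorr_unique` (any solution of the recursion with
  any anchoring convention equals `connCorr μ`) and `connCorr_map` (relabelling invariance under
  an arbitrary injection `ι ↪ ι'` of linearly ordered index types — in particular invariance under
  permutations of the sites and independence of the order used for anchoring).

* `connCorr_eq_zero_of_indep` — **connectedness across independent groups**: if `μ(∅) = 1` and
  `μ(T) = μ(T ∩ A) μ(T ∖ A)` for all `T ⊆ S` (the `A`-sites are independent of the others, nothing
  assumed inside either group), then `G_c(S) = 0` whenever `S` meets both `A` and its complement
  [cite: Kardar2007, §2.3 (text after eq. (2.48))]; strictly extends `connCorr_eq_zero_of_prod`.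

* `moment_eq_sum_filter_of_indicator`, `connCorr_pair_indicator` — for `{0,1}`-valued (click /
  indicator) observables the moments are joint click probabilities, so `connCorr (moment w n)` are
  the click cumulants / connected correlation functions used to benchmark boson samplers
  [cite: HangleiterEisert2023, section “Verification”].

Not written out here: the explicit partition expansion `μ(S) = Σ_{π ∈ Π(S)} ∏_{B∈π} G_c(B)` as a
sum over `Finpartition`s (the anchored cluster relation at every anchor is the form the lane uses).

## References
* [Kardar2007] M. Kardar, *Statistical Physics of Particles*, CUP 2007, §2.2–2.3 (read via
  `lit read book:kardar2007-statistical-physics-particles`, chunks 40, 45–48).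
* [HangleiterEisert2023] D. Hangleiter, J. Eisert, *Computational advantage of quantum random
  sampling*, Rev. Mod. Phys. 95, 035001 (2023) = arXiv:2206.04079 (read via `lit read
  arxiv:2206.04079`, chunks 55 and 60: correlation-function / cumulant benchmarks).
* [ZhengEtAl2026] Y.-G. Zheng et al., *Quantifying quantum computational advantage on a processor
  of ultracold atoms*, Phys. Rev. X 16, 021057 (2026) = arXiv:2210.08556v2, eq. (3), App. F.4.
-/

noncomputable section

open Finset

namespace Literature.Probability.Moments

variable {ι : Type*} [LinearOrder ι]

/-- The proper subsets of `S.erase a` index the anchored recursion: `T ↦ insert a T` runs over the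
sets `a ∈ T' ⊊ S`. [folklore] -/
def anchoredIndex (S : Finset ι) (a : ι) : Finset (Finset ι) :=
  ((S.erase a).powerset).erase (S.erase a)

/-- Membership in `anchoredIndex`. [folklore] -/
theorem mem_anchoredIndex {S : Finset ι} {a : ι} {T : Finset ι} :
    T ∈ anchoredIndex S a ↔ T ⊆ S.erase a ∧ T ≠ S.erase a := by
  simp [anchoredIndex, and_comm]

/-- `|{a} ∪ T'| < |S|` for `T'` in the anchored index — the recursion is well-founded on `|S|`.
[folklore] -/
theorem card_insert_lt_of_mem_anchoredIndex {S : Finset ι} {a : ι} (ha : a ∈ S) {T : Finset ι}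
    (hT : T ∈ anchoredIndex S a) : (insert a T).card < S.card := by
  rw [mem_anchoredIndex] at hT
  obtain ⟨hsub, hne⟩ := hT
  have haT : a ∉ T := fun h => by simpa using hsub h
  have hlt : T.card < (S.erase a).card := card_lt_card (Finset.ssubset_iff_subset_ne.mpr ⟨hsub, hne⟩)
  rw [card_erase_of_mem ha] at hlt
  rw [card_insert_of_notMem haT]
  have : 0 < S.card := card_pos.mpr ⟨a, ha⟩
  omega

/-- **Connected correlation (joint cumulant) by the anchored moment–cumulant recursion**:
`G_c(∅) = 0` (convention) and, for `S ≠ ∅` with anchor `a = min S`,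
`G_c(S) = μ(S) − Σ_{T' ⊊ S∖{a}} G_c({a} ∪ T') · μ((S∖{a}) ∖ T')`.
[cite: Kardar2007, §2.2 eq. (2.12), §2.3 eq. (2.40)] [cite: ZhengEtAl2026, eq. (3), App. F.4 eq. (F7)] -/
def connCorr (μ : Finset ι → ℝ) : Finset ι → ℝ
  | S =>
    if h : S.Nonempty then
      μ S - ∑ T ∈ (anchoredIndex S (S.min' h)).attach,
        connCorr μ (insert (S.min' h) T.1) * μ ((S.erase (S.min' h)) \ T.1)
    else 0
termination_by S => S.card
decreasing_by
  exact card_insert_lt_of_mem_anchoredIndex (min'_mem S h) T.2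

/-- The recursion as an equation (plain sum, no `attach`). [folklore] -/
theorem connCorr_of_nonempty (μ : Finset ι → ℝ) {S : Finset ι} (h : S.Nonempty) :
    connCorr μ S = μ S - ∑ T ∈ anchoredIndex S (S.min' h),
        connCorr μ (insert (S.min' h) T) * μ ((S.erase (S.min' h)) \ T) := by
  rw [connCorr, dif_pos h]
  congr 1
  exact sum_attach (anchoredIndex S (S.min' h))
    (fun T => connCorr μ (insert (S.min' h) T) * μ ((S.erase (S.min' h)) \ T))

/-- `G_c(∅) = 0`. [folklore] -/
@[simp] theorem connCorr_empty (μ : Finset ι → ℝ) : connCorr μ ∅ = 0 := by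
  rw [connCorr, dif_neg (by simp)]

/-- `G_c({i}) = μ({i}) = ⟨n_i⟩`. [cite: Kardar2007, §2.3 eq. (2.40)] -/
@[simp] theorem connCorr_singleton (μ : Finset ι → ℝ) (i : ι) : connCorr μ {i} = μ {i} := by
  rw [connCorr_of_nonempty μ (singleton_nonempty i)]
  have : anchoredIndex ({i} : Finset ι) (({i} : Finset ι).min' (singleton_nonempty i)) = ∅ := by
    simp [anchoredIndex]
  rw [this, sum_empty, sub_zero]

/-- The anchored index of a pair anchored at its minimum is `{∅}`. [folklore] -/
theorem anchoredIndex_pair {i j : ι} (hij : i < j) :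
    anchoredIndex ({i, j} : Finset ι) i = {∅} := by
  have hne : i ≠ j := ne_of_lt hij
  have h1 : ({i, j} : Finset ι).erase i = {j} := by
    ext x
    simp only [mem_erase, mem_insert, mem_singleton]
    constructor
    · rintro ⟨hx, (rfl | rfl)⟩
      · exact absurd rfl hx
      · rfl
    · rintro rfl; exact ⟨hne.symm, Or.inr rfl⟩
  rw [anchoredIndex, h1]
  ext T
  simp only [mem_erase, mem_powerset, mem_singleton, subset_singleton_iff]
  constructor
  · rintro ⟨hT, (rfl | rfl)⟩
    · rfl
    · exact absurd rfl hT
  · rintro rfl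
    exact ⟨by simp, Or.inl rfl⟩

/-- `G_c({i,j}) = μ({i,j}) − μ({i}) μ({j})` for `i < j` (the connected two-point function /
covariance). [cite: Kardar2007, §2.3 eq. (2.40)] -/
theorem connCorr_pair_of_lt (μ : Finset ι → ℝ) {i j : ι} (hij : i < j) :
    connCorr μ {i, j} = μ {i, j} - μ {i} * μ {j} := by
  have hne : i ≠ j := ne_of_lt hij
  have h : ({i, j} : Finset ι).Nonempty := insert_nonempty i {j}
  have hmin : ({i, j} : Finset ι).min' h = i := by
    apply le_antisymm
    · exact min'_le _ _ (by simp)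
    · apply le_min'
      intro y hy
      simp only [mem_insert, mem_singleton] at hy
      rcases hy with rfl | rfl
      · exact le_rfl
      · exact le_of_lt hij
  rw [connCorr_of_nonempty μ h]
  simp only [hmin]
  rw [anchoredIndex_pair hij, sum_singleton]
  have h1 : ({i, j} : Finset ι).erase i = {j} := by
    ext x
    simp only [mem_erase, mem_insert, mem_singleton]
    constructor
    · rintro ⟨hx, (rfl | rfl)⟩
      · exact absurd rfl hx
      · rfl
    · rintro rfl; exact ⟨hne.symm, Or.inr rfl⟩
  rw [h1, sdiff_empty, insert_empty_eq, connCorr_singleton]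

/-- `G_c({i,j}) = μ({i,j}) − μ({i}) μ({j})` for `i ≠ j`. [cite: Kardar2007, §2.3 eq. (2.40)] -/
theorem connCorr_pair (μ : Finset ι → ℝ) {i j : ι} (hij : i ≠ j) :
    connCorr μ {i, j} = μ {i, j} - μ {i} * μ {j} := by
  rcases lt_or_gt_of_ne hij with h | h
  · exact connCorr_pair_of_lt μ h
  · rw [pair_comm, connCorr_pair_of_lt μ h, mul_comm]

/-- **Connectedness.** If the moments factorise over sites on all subsets of `S`,
`μ(T) = ∏_{i∈T} m_i` (`T ⊆ S`), then the connected correlation of any `S` with `2 ≤ |S|` vanishes.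
[cite: Kardar2007, §2.3 (independent variables have vanishing cross cumulants, text after eq. (2.48))]
[cite: ZhengEtAl2026, App. F.4 (the connected part "cannot be described by lower-order correlations")] -/
theorem connCorr_eq_zero_of_prod (μ : Finset ι → ℝ) (m : ι → ℝ) :
    ∀ (S : Finset ι), (∀ T ⊆ S, μ T = ∏ i ∈ T, m i) → 2 ≤ S.card → connCorr μ S = 0 := by
  intro S
  induction S using Finset.strongInduction with
  | H S ih =>
    intro hμ hcard
    have h : S.Nonempty := card_pos.mp (by omega)
    set a := S.min' h with ha
    have haS : a ∈ S := min'_mem S h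
    rw [connCorr_of_nonempty μ h, ← ha]
    -- the `T = ∅` term equals `μ S`; every other term vanishes by the induction hypothesis
    have hmem : (∅ : Finset ι) ∈ anchoredIndex S a := by
      rw [mem_anchoredIndex]
      refine ⟨empty_subset _, fun h0 => ?_⟩
      have : (S.erase a).card = 0 := by rw [← h0]; rfl
      rw [card_erase_of_mem haS] at this
      omega
    rw [sum_eq_single_of_mem ∅ hmem]
    · rw [sdiff_empty, insert_empty_eq, connCorr_singleton,
        hμ {a} (singleton_subset_iff.mpr haS), hμ (S.erase a) (erase_subset a S), hμ S subset_rfl,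
        prod_singleton, mul_prod_erase S m haS, sub_self]
    · intro T hT hT0
      have hT' := mem_anchoredIndex.mp hT
      have hsubS : insert a T ⊆ S :=
        insert_subset haS (hT'.1.trans (erase_subset a S))
      have hss : insert a T ⊂ S := by
        refine Finset.ssubset_iff_subset_ne.mpr ⟨hsubS, fun hEq => ?_⟩
        have := card_insert_lt_of_mem_anchoredIndex haS hT
        rw [hEq] at this
        exact lt_irrefl _ this
      have haT : a ∉ T := fun h' => by simpa using hT'.1 h'
      have hcard2 : 2 ≤ (insert a T).card := by
        rw [card_insert_of_notMem haT]
        have : 0 < T.card := card_pos.mpr (nonempty_iff_ne_empty.mpr hT0)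
        omega
      rw [ih (insert a T) hss (fun T' hT'' => hμ T' (hT''.trans hsubS)) hcard2, zero_mul]

/-- **The cluster relation, anchored form.** With the normalisation `μ(∅) = 1`, for `S ≠ ∅` and
`a = min S`: `μ(S) = Σ_{T' ⊆ S∖{a}} G_c({a} ∪ T') · μ((S∖{a}) ∖ T')` — the moment is the sum over
the connected part containing the anchor times the moment of the rest.
[cite: Kardar2007, §2.2 eq. (2.12) and §2.3 eq. (2.40)] -/
theorem moment_eq_sum_connCorr (μ : Finset ι → ℝ) (hμ : μ ∅ = 1) {S : Finset ι} (h : S.Nonempty) :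
    μ S = ∑ T ∈ (S.erase (S.min' h)).powerset,
        connCorr μ (insert (S.min' h) T) * μ ((S.erase (S.min' h)) \ T) := by
  set a := S.min' h with ha
  have haS : a ∈ S := min'_mem S h
  have htop : S.erase a ∈ (S.erase a).powerset := mem_powerset.mpr subset_rfl
  rw [← add_sum_erase _ _ htop, sdiff_self, bot_eq_empty, hμ, mul_one, insert_erase haS]
  have hidx : (S.erase a).powerset.erase (S.erase a) = anchoredIndex S a := rfl
  rw [hidx, connCorr_of_nonempty μ h, ← ha]
  ring

/-- The anchored index of a triple `i < j < k` anchored at `i` is `{∅, {j}, {k}}`. [folklore] -/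
theorem anchoredIndex_triple {i j k : ι} (hij : i < j) (hjk : j < k) :
    anchoredIndex ({i, j, k} : Finset ι) i = {∅, {j}, {k}} := by
  have hij' : i ≠ j := ne_of_lt hij
  have hik' : i ≠ k := ne_of_lt (hij.trans hjk)
  have hjk' : j ≠ k := ne_of_lt hjk
  have h1 : ({i, j, k} : Finset ι).erase i = {j, k} := by
    ext x
    simp only [mem_erase, mem_insert, mem_singleton]
    constructor
    · rintro ⟨hx, (rfl | rfl | rfl)⟩
      · exact absurd rfl hx
      · exact Or.inl rfl
      · exact Or.inr rfl
    · rintro (rfl | rfl)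
      · exact ⟨hij'.symm, Or.inr (Or.inl rfl)⟩
      · exact ⟨hik'.symm, Or.inr (Or.inr rfl)⟩
  rw [anchoredIndex, h1]
  ext T
  simp only [mem_erase, mem_powerset, mem_insert, mem_singleton]
  constructor
  · rintro ⟨hT, hsub⟩
    by_cases hj : j ∈ T
    · by_cases hk : k ∈ T
      · exfalso; apply hT
        ext x; simp only [mem_insert, mem_singleton]
        constructor
        · intro hx; have := hsub hx; simpa using this
        · rintro (rfl | rfl); exacts [hj, hk]
      · right; left
        ext x; simp only [mem_singleton]
        constructor
        · intro hx; have := hsub hx; simp only [mem_insert, mem_singleton] at this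
          rcases this with rfl | rfl
          · rfl
          · exact absurd hx hk
        · rintro rfl; exact hj
    · by_cases hk : k ∈ T
      · right; right
        ext x; simp only [mem_singleton]
        constructor
        · intro hx; have := hsub hx; simp only [mem_insert, mem_singleton] at this
          rcases this with rfl | rfl
          · exact absurd hx hj
          · rfl
        · rintro rfl; exact hk
      · left
        ext x; simp only [notMem_empty, iff_false]
        intro hx; have := hsub hx; simp only [mem_insert, mem_singleton] at this
        rcases this with rfl | rfl
        · exact hj hx
        · exact hk hx
  · rintro (rfl | rfl | rfl)
    · refine ⟨fun h0 => ?_, empty_subset _⟩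
      have hj : j ∈ (∅ : Finset ι) := by rw [h0]; simp
      exact notMem_empty j hj
    · refine ⟨fun h0 => hjk' ?_, by simp⟩
      have hk : k ∈ ({j} : Finset ι) := by rw [h0]; simp
      exact (mem_singleton.mp hk).symm
    · refine ⟨fun h0 => hjk' ?_, by simp⟩
      have hj : j ∈ ({k} : Finset ι) := by rw [h0]; simp
      exact mem_singleton.mp hj

/-- `G_c({i,j,k}) = μ_{ijk} − μ_i μ_{jk} − μ_j μ_{ik} − μ_k μ_{ij} + 2 μ_i μ_j μ_k` for `i < j < k`
(the third joint cumulant). [cite: Kardar2007, §2.2 eq. (2.10)–(2.12) (third cumulant)] -/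
theorem connCorr_triple (μ : Finset ι → ℝ) {i j k : ι} (hij : i < j) (hjk : j < k) :
    connCorr μ {i, j, k} = μ {i, j, k} - μ {i} * μ {j, k} - μ {j} * μ {i, k} - μ {k} * μ {i, j}
      + 2 * μ {i} * μ {j} * μ {k} := by
  have hik : i < k := hij.trans hjk
  have hij' : i ≠ j := ne_of_lt hij
  have hik' : i ≠ k := ne_of_lt hik
  have hjk' : j ≠ k := ne_of_lt hjk
  have h : ({i, j, k} : Finset ι).Nonempty := insert_nonempty i _
  have hmin : ({i, j, k} : Finset ι).min' h = i := by
    apply le_antisymm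
    · exact min'_le _ _ (by simp)
    · apply le_min'
      intro y hy
      simp only [mem_insert, mem_singleton] at hy
      rcases hy with rfl | rfl | rfl
      · exact le_rfl
      · exact le_of_lt hij
      · exact le_of_lt hik
  have h1 : ({i, j, k} : Finset ι).erase i = {j, k} := by
    ext x
    simp only [mem_erase, mem_insert, mem_singleton]
    constructor
    · rintro ⟨hx, (rfl | rfl | rfl)⟩
      · exact absurd rfl hx
      · exact Or.inl rfl
      · exact Or.inr rfl
    · rintro (rfl | rfl)
      · exact ⟨hij'.symm, Or.inr (Or.inl rfl)⟩
      · exact ⟨hik'.symm, Or.inr (Or.inr rfl)⟩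
  rw [connCorr_of_nonempty μ h]
  simp only [hmin]
  rw [anchoredIndex_triple hij hjk, h1]
  have hne1 : (∅ : Finset ι) ≠ {j} := (singleton_ne_empty j).symm
  have hne2 : (∅ : Finset ι) ≠ {k} := (singleton_ne_empty k).symm
  have hne3 : ({j} : Finset ι) ≠ {k} := by
    intro h0; apply hjk'; have : j ∈ ({k} : Finset ι) := by rw [← h0]; simp
    simpa using this
  rw [sum_insert (by simp [hne1, hne2]), sum_pair hne3]
  -- the three terms
  have hd0 : ({j, k} : Finset ι) \ ∅ = {j, k} := sdiff_empty
  have hdj : ({j, k} : Finset ι) \ {j} = {k} := by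
    ext x; simp only [mem_sdiff, mem_insert, mem_singleton]
    constructor
    · rintro ⟨(rfl | rfl), hx⟩
      · exact absurd rfl hx
      · rfl
    · rintro rfl; exact ⟨Or.inr rfl, hjk'.symm⟩
  have hdk : ({j, k} : Finset ι) \ {k} = {j} := by
    ext x; simp only [mem_sdiff, mem_insert, mem_singleton]
    constructor
    · rintro ⟨(rfl | rfl), hx⟩
      · rfl
      · exact absurd rfl hx
    · rintro rfl; exact ⟨Or.inl rfl, hjk'⟩
  rw [hd0, hdj, hdk, insert_empty_eq, connCorr_singleton, connCorr_pair_of_lt μ hij,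
    connCorr_pair_of_lt μ hik]
  ring

/-! ### Anchor independence (symmetry of the joint cumulant in its arguments)

The recursion defining `connCorr` is anchored at `min S`; the value does not depend on that choice.
The printed route is the partition expansion `μ(S) = Σ_{π ∈ Π(S)} ∏_{B ∈ π} G_c(B)`
[cite: Kardar2007, §2.3 eq. (2.40)]: grouping the partitions by the block containing ANY fixed
`a ∈ S` gives `μ(S) = Σ_{a ∈ T ⊆ S} G_c(T) μ(S ∖ T)`. We prove the anchored form of that statement
directly, by strong induction on `S` and a double-sum exchange (no set partitions needed): for two
anchors `a ≠ b` the terms with `a, b ∈ T` agree, and after one more application of the recursion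
(at the other anchor, on the strictly smaller set `S ∖ T`) the remaining terms are exchanged by
`T ↦ S ∖ T` and `(T, U) ↦ (U, T)`. -/

/-- The anchored cluster sum at an ARBITRARY anchor `a`:
`Σ_{T ⊆ S, a ∈ T, T ≠ S} G_c(T) · μ(S ∖ T)` — the sum subtracted from `μ(S)` in the
moment–cumulant recursion when the set partitions of `S` are grouped by the block containing `a`.
[cite: Kardar2007, §2.3 eq. (2.40)] [cite: ZhengEtAl2026, eq. (3)] -/
def anchoredSum (μ : Finset ι → ℝ) (S : Finset ι) (a : ι) : ℝ :=
  ∑ T ∈ S.powerset.filter (fun T => a ∈ T ∧ T ≠ S), connCorr μ T * μ (S \ T)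

/-- Membership in the index set of `anchoredSum`. [folklore] -/
theorem mem_anchorFilter {S T : Finset ι} {a : ι} :
    T ∈ S.powerset.filter (fun T => a ∈ T ∧ T ≠ S) ↔ T ⊆ S ∧ a ∈ T ∧ T ≠ S := by
  rw [mem_filter, mem_powerset]

/-- The definitional sum over `anchoredIndex S a` (sets `T' ⊊ S ∖ {a}`, re-anchored as `{a} ∪ T'`)
equals the anchored cluster sum at `a`. [folklore] -/
theorem sum_anchoredIndex_eq_anchoredSum (μ : Finset ι → ℝ) {S : Finset ι} {a : ι} (ha : a ∈ S) :
    ∑ T ∈ anchoredIndex S a, connCorr μ (insert a T) * μ ((S.erase a) \ T)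
      = anchoredSum μ S a := by
  unfold anchoredSum
  refine sum_nbij' (fun T => insert a T) (fun T => T.erase a) ?_ ?_ ?_ ?_ ?_
  · intro T hT
    obtain ⟨hsub, hne⟩ := mem_anchoredIndex.mp hT
    have haT : a ∉ T := fun h => by simpa using hsub h
    rw [mem_anchorFilter]
    refine ⟨insert_subset ha (hsub.trans (erase_subset a S)), mem_insert_self a T,
      fun hEq => hne ?_⟩
    rw [← hEq, erase_insert haT]
  · intro T hT
    obtain ⟨hsub, haT, hne⟩ := mem_anchorFilter.mp hT
    rw [mem_anchoredIndex]
    refine ⟨erase_subset_erase a hsub, fun hEq => hne ?_⟩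
    rw [← insert_erase haT, hEq, insert_erase ha]
  · intro T hT
    obtain ⟨hsub, -⟩ := mem_anchoredIndex.mp hT
    have haT : a ∉ T := fun h => by simpa using hsub h
    exact erase_insert haT
  · intro T hT
    obtain ⟨-, haT, -⟩ := mem_anchorFilter.mp hT
    exact insert_erase haT
  · intro T _
    rw [erase_sdiff_comm, ← sdiff_insert]

/-- The defining recursion with the subtracted sum written as `anchoredSum` at `min S`.
[cite: Kardar2007, §2.3 eq. (2.40)] -/
theorem connCorr_eq_sub_anchoredSum_min' (μ : Finset ι → ℝ) {S : Finset ι} (h : S.Nonempty) :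
    connCorr μ S = μ S - anchoredSum μ S (S.min' h) := by
  rw [connCorr_of_nonempty μ h, sum_anchoredIndex_eq_anchoredSum μ (min'_mem S h)]

/-- **Anchor independence of the cluster sum**: for any two sites `a, b ∈ S`,
`Σ_{a ∈ T ⊊ S} G_c(T) μ(S ∖ T) = Σ_{b ∈ T ⊊ S} G_c(T) μ(S ∖ T)`.
[cite: Kardar2007, §2.3 eq. (2.40) (the partition expansion is symmetric in the sites)] -/
theorem anchoredSum_eq_anchoredSum (μ : Finset ι → ℝ) :
    ∀ (S : Finset ι) {a b : ι}, a ∈ S → b ∈ S → anchoredSum μ S a = anchoredSum μ S b := by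
  intro S
  induction S using Finset.strongInduction with
  | H S ih =>
  intro a b ha hb
  -- the recursion at an ARBITRARY anchor, for proper subsets (induction hypothesis)
  have hrec : ∀ R : Finset ι, R ⊂ S → ∀ c ∈ R, μ R = connCorr μ R + anchoredSum μ R c := by
    intro R hRS c hc
    have hR : R.Nonempty := ⟨c, hc⟩
    rw [connCorr_eq_sub_anchoredSum_min' μ hR, ih R hRS (min'_mem R hR) hc]
    ring
  by_cases hab : a = b
  · rw [hab]
  -- split both anchored sums according to membership of the other anchor
  have hsplit : ∀ c d : ι, anchoredSum μ S c =
      (∑ T ∈ S.powerset.filter (fun T => (c ∈ T ∧ T ≠ S) ∧ d ∈ T), connCorr μ T * μ (S \ T))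
      + ∑ T ∈ S.powerset.filter (fun T => (c ∈ T ∧ T ≠ S) ∧ d ∉ T),
          connCorr μ T * μ (S \ T) := by
    intro c d
    unfold anchoredSum
    rw [← sum_filter_add_sum_filter_not (S.powerset.filter fun T => c ∈ T ∧ T ≠ S)
      (fun T => d ∈ T), filter_filter, filter_filter]
  have hcommon : S.powerset.filter (fun T => (a ∈ T ∧ T ≠ S) ∧ b ∈ T)
      = S.powerset.filter (fun T => (b ∈ T ∧ T ≠ S) ∧ a ∈ T) :=
    filter_congr (fun T _ => by tauto)
  -- expand `μ (S \ T)` by the recursion at the missing anchor (legitimate: `S \ T ⊊ S`)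
  have hexp : ∀ c d : ι, c ∈ S → d ∈ S →
      ∑ T ∈ S.powerset.filter (fun T => (c ∈ T ∧ T ≠ S) ∧ d ∉ T), connCorr μ T * μ (S \ T)
      = (∑ T ∈ S.powerset.filter (fun T => (c ∈ T ∧ T ≠ S) ∧ d ∉ T),
          connCorr μ T * connCorr μ (S \ T))
        + ∑ T ∈ S.powerset.filter (fun T => (c ∈ T ∧ T ≠ S) ∧ d ∉ T),
          connCorr μ T * anchoredSum μ (S \ T) d := by
    intro c d hc hd
    rw [← sum_add_distrib]
    refine sum_congr rfl fun T hT => ?_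
    rw [mem_filter, mem_powerset] at hT
    obtain ⟨-, ⟨hcT, -⟩, hdT⟩ := hT
    have hsub : S \ T ⊂ S := by
      refine Finset.ssubset_iff_subset_ne.mpr ⟨sdiff_subset, fun hEq => ?_⟩
      have hcST : c ∈ S \ T := by rw [hEq]; exact hc
      exact (mem_sdiff.mp hcST).2 hcT
    rw [hrec (S \ T) hsub d (mem_sdiff.mpr ⟨hd, hdT⟩), mul_add]
  -- part 1: `T ↦ S \ T`
  have hpart1 :
      ∑ T ∈ S.powerset.filter (fun T => (a ∈ T ∧ T ≠ S) ∧ b ∉ T),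
          connCorr μ T * connCorr μ (S \ T)
      = ∑ T ∈ S.powerset.filter (fun T => (b ∈ T ∧ T ≠ S) ∧ a ∉ T),
          connCorr μ T * connCorr μ (S \ T) := by
    refine sum_nbij' (fun T => S \ T) (fun T => S \ T) ?_ ?_ ?_ ?_ ?_
    · intro T hT
      simp only [mem_filter, mem_powerset] at hT ⊢
      obtain ⟨-, ⟨haT, -⟩, hbT⟩ := hT
      refine ⟨sdiff_subset, ⟨mem_sdiff.mpr ⟨hb, hbT⟩, fun hEq => ?_⟩,
        fun h => (mem_sdiff.mp h).2 haT⟩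
      have haST : a ∈ S \ T := by rw [hEq]; exact ha
      exact (mem_sdiff.mp haST).2 haT
    · intro T hT
      simp only [mem_filter, mem_powerset] at hT ⊢
      obtain ⟨-, ⟨hbT, -⟩, haT⟩ := hT
      refine ⟨sdiff_subset, ⟨mem_sdiff.mpr ⟨ha, haT⟩, fun hEq => ?_⟩,
        fun h => (mem_sdiff.mp h).2 hbT⟩
      have hbST : b ∈ S \ T := by rw [hEq]; exact hb
      exact (mem_sdiff.mp hbST).2 hbT
    · intro T hT
      simp only [mem_filter, mem_powerset] at hT
      exact Finset.sdiff_sdiff_eq_self hT.1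
    · intro T hT
      simp only [mem_filter, mem_powerset] at hT
      exact Finset.sdiff_sdiff_eq_self hT.1
    · intro T hT
      simp only [mem_filter, mem_powerset] at hT
      rw [Finset.sdiff_sdiff_eq_self hT.1, mul_comm]
  -- part 2: `(T, U) ↦ (U, T)`
  have hmem : ∀ T U : Finset ι,
      T ∈ S.powerset.filter (fun T => (a ∈ T ∧ T ≠ S) ∧ b ∉ T) ∧
        U ∈ (S \ T).powerset.filter (fun U => b ∈ U ∧ U ≠ S \ T) ↔
      T ∈ (S \ U).powerset.filter (fun T => a ∈ T ∧ T ≠ S \ U) ∧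
        U ∈ S.powerset.filter (fun U => (b ∈ U ∧ U ≠ S) ∧ a ∉ U) := by
    intro T U
    simp only [mem_filter, mem_powerset]
    constructor
    · rintro ⟨⟨hTS, ⟨haT, -⟩, hbT⟩, hUST, hbU, hUne⟩
      have hUS : U ⊆ S := hUST.trans sdiff_subset
      have hdisj : ∀ x, x ∈ U → x ∉ T := fun x hxU hxT => (mem_sdiff.mp (hUST hxU)).2 hxT
      have haU : a ∉ U := fun h => hdisj a h haT
      refine ⟨⟨fun x hxT => mem_sdiff.mpr ⟨hTS hxT, fun hxU => hdisj x hxU hxT⟩, haT,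
        fun hEq => hUne ?_⟩, hUS, ⟨hbU, fun hEq => haU (by rw [hEq]; exact ha)⟩, haU⟩
      rw [hEq, Finset.sdiff_sdiff_eq_self hUS]
    · rintro ⟨⟨hTSU, haT, hTne⟩, hUS, ⟨hbU, -⟩, haU⟩
      have hTS : T ⊆ S := hTSU.trans sdiff_subset
      have hdisj : ∀ x, x ∈ T → x ∉ U := fun x hxT hxU => (mem_sdiff.mp (hTSU hxT)).2 hxU
      have hbT : b ∉ T := fun h => hdisj b h hbU
      refine ⟨⟨hTS, ⟨haT, fun hEq => hbT (by rw [hEq]; exact hb)⟩, hbT⟩,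
        fun x hxU => mem_sdiff.mpr ⟨hUS hxU, fun hxT => hdisj x hxT hxU⟩, hbU,
        fun hEq => hTne ?_⟩
      rw [hEq, Finset.sdiff_sdiff_eq_self hTS]
  have hpart2 :
      ∑ T ∈ S.powerset.filter (fun T => (a ∈ T ∧ T ≠ S) ∧ b ∉ T),
          connCorr μ T * anchoredSum μ (S \ T) b
      = ∑ T ∈ S.powerset.filter (fun T => (b ∈ T ∧ T ≠ S) ∧ a ∉ T),
          connCorr μ T * anchoredSum μ (S \ T) a := by
    unfold anchoredSum
    simp_rw [mul_sum]
    rw [sum_comm' hmem]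
    refine sum_congr rfl fun U _ => sum_congr rfl fun T _ => ?_
    rw [sdiff_sdiff_comm]
    ring
  rw [hsplit a b, hsplit b a, hcommon, add_right_inj, hexp a b ha hb, hexp b a hb ha, hpart1, hpart2]

/-- **Anchor independence of the recursion.** For ANY `a ∈ S`:
`G_c(S) = μ(S) − Σ_{a ∈ T ⊊ S} G_c(T) · μ(S ∖ T)` — the defining recursion (anchored at `min S`)
holds at every anchor, so `connCorr` does not depend on the linear order used to pick the anchor
(see `connCorr_unique`, `connCorr_map`). [cite: Kardar2007, §2.3 eq. (2.40)]
[cite: ZhengEtAl2026, eq. (3) (the recursive formula, stated without a distinguished site)] -/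
theorem connCorr_eq_sub_anchoredSum (μ : Finset ι → ℝ) {S : Finset ι} {a : ι} (ha : a ∈ S) :
    connCorr μ S = μ S - anchoredSum μ S a := by
  have h : S.Nonempty := ⟨a, ha⟩
  rw [connCorr_eq_sub_anchoredSum_min' μ h, anchoredSum_eq_anchoredSum μ S (min'_mem S h) ha]

/-- `connCorr_eq_sub_anchoredSum` with the sum written out. [cite: Kardar2007, §2.3 eq. (2.40)] -/
theorem connCorr_eq_of_mem (μ : Finset ι → ℝ) {S : Finset ι} {a : ι} (ha : a ∈ S) :
    connCorr μ S = μ S - ∑ T ∈ S.powerset.filter (fun T => a ∈ T ∧ T ≠ S),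
        connCorr μ T * μ (S \ T) :=
  connCorr_eq_sub_anchoredSum μ ha

/-- **The cluster relation at an arbitrary anchor.** With `μ(∅) = 1`, for every `a ∈ S`:
`μ(S) = Σ_{T ⊆ S, a ∈ T} G_c(T) · μ(S ∖ T)` (moment = connected part containing `a` times the
moment of the rest). [cite: Kardar2007, §2.2 eq. (2.12), §2.3 eq. (2.40)] -/
theorem moment_eq_sum_connCorr_of_mem (μ : Finset ι → ℝ) (hμ : μ ∅ = 1) {S : Finset ι} {a : ι}
    (ha : a ∈ S) :
    μ S = ∑ T ∈ S.powerset.filter (fun T => a ∈ T), connCorr μ T * μ (S \ T) := by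
  have hS : S ∈ S.powerset.filter (fun T => a ∈ T) :=
    mem_filter.mpr ⟨mem_powerset.mpr subset_rfl, ha⟩
  rw [← add_sum_erase _ _ hS, sdiff_self, bot_eq_empty, hμ, mul_one]
  have hidx : (S.powerset.filter (fun T => a ∈ T)).erase S
      = S.powerset.filter (fun T => a ∈ T ∧ T ≠ S) := by
    ext T
    simp only [mem_erase, mem_filter, mem_powerset]
    tauto
  rw [hidx, connCorr_eq_of_mem μ ha]
  ring

/-- **Uniqueness.** Any `G` with `G(∅) = 0` that satisfies the moment–cumulant recursion at SOME
anchor of every non-empty `S` coincides with `connCorr μ` — so every anchoring convention (and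
every linear order) defines the same joint cumulants. [cite: Kardar2007, §2.3 eq. (2.40)] -/
theorem connCorr_unique (μ G : Finset ι → ℝ) (h0 : G ∅ = 0)
    (hrec : ∀ S : Finset ι, S.Nonempty → ∃ a ∈ S,
      G S = μ S - ∑ T ∈ S.powerset.filter (fun T => a ∈ T ∧ T ≠ S), G T * μ (S \ T)) :
    ∀ S : Finset ι, G S = connCorr μ S := by
  intro S
  induction S using Finset.strongInduction with
  | H S ih =>
  rcases S.eq_empty_or_nonempty with hS | hS
  · rw [hS, h0, connCorr_empty]
  · obtain ⟨a, ha, hG⟩ := hrec S hS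
    rw [hG, connCorr_eq_of_mem μ ha]
    congr 1
    refine sum_congr rfl fun T hT => ?_
    rw [mem_anchorFilter] at hT
    rw [ih T (Finset.ssubset_iff_subset_ne.mpr ⟨hT.1, hT.2.2⟩)]

/-- **Relabelling invariance (symmetry in the arguments).** For an injection `e : ι ↪ ι'` between
index types carrying ARBITRARY linear orders (e need not be monotone), the joint cumulants of the
pulled-back moment function are the pulled-back joint cumulants:
`connCorr (μ' ∘ map e) S = connCorr μ' (S.map e)`. In particular `connCorr` is invariant under every
permutation of the sites and independent of the order used for anchoring.
[cite: Kardar2007, §2.3 eq. (2.40)] -/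
theorem connCorr_map {ι' : Type*} [LinearOrder ι'] (e : ι ↪ ι') (μ' : Finset ι' → ℝ)
    (S : Finset ι) :
    connCorr (fun T : Finset ι => μ' (T.map e)) S = connCorr μ' (S.map e) := by
  symm
  refine connCorr_unique (fun T : Finset ι => μ' (T.map e)) (fun R => connCorr μ' (R.map e))
    ?_ ?_ S
  · simp only [map_empty, connCorr_empty]
  · intro R hR
    refine ⟨R.min' hR, min'_mem R hR, ?_⟩
    rw [connCorr_eq_of_mem μ' (mem_map_of_mem e (min'_mem R hR))]
    congr 1
    symm
    refine sum_nbij' (fun T => T.map e) (fun T' => R.filter (fun x => e x ∈ T')) ?_ ?_ ?_ ?_ ?_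
    · intro T hT
      obtain ⟨hTR, haT, hne⟩ := mem_anchorFilter.mp hT
      rw [mem_anchorFilter]
      exact ⟨map_subset_map.mpr hTR, mem_map_of_mem e haT, fun hEq => hne (map_inj.mp hEq)⟩
    · intro T' hT'
      obtain ⟨hT'R, haT', hne⟩ := mem_anchorFilter.mp hT'
      rw [mem_anchorFilter]
      refine ⟨filter_subset _ R, mem_filter.mpr ⟨min'_mem R hR, haT'⟩, fun hEq => hne ?_⟩
      apply Subset.antisymm hT'R
      intro y hy
      obtain ⟨x, hx, rfl⟩ := mem_map.mp hy
      have hx' : x ∈ R.filter (fun x => e x ∈ T') := by rw [hEq]; exact hx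
      exact (mem_filter.mp hx').2
    · intro T hT
      obtain ⟨hTR, -, -⟩ := mem_anchorFilter.mp hT
      ext x
      simp only [mem_filter, mem_map' e]
      exact ⟨fun h => h.2, fun h => ⟨hTR h, h⟩⟩
    · intro T' hT'
      obtain ⟨hT'R, -, -⟩ := mem_anchorFilter.mp hT'
      ext y
      constructor
      · intro hy
        obtain ⟨x, hx, rfl⟩ := mem_map.mp hy
        exact (mem_filter.mp hx).2
      · intro hy
        obtain ⟨x, hx, rfl⟩ := mem_map.mp (hT'R hy)
        exact mem_map_of_mem e (mem_filter.mpr ⟨hx, hy⟩)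
    · intro T _
      rw [map_sdiff]

/-! ### Connectedness across two independent groups of sites -/

/-- **Connectedness across independent groups.** If the normalised moments (`μ(∅) = 1`) FACTORISE
ACROSS a bipartition of the sites — `μ(T) = μ(T ∩ A) · μ(T ∖ A)` for all `T ⊆ S` (the observables in
`A` are independent of those outside `A`; no assumption inside either group) — then the joint
cumulant of every `S` that meets both `A` and its complement vanishes. This is the textbook
statement "cross cumulants of mutually independent sets of variables vanish"
[cite: Kardar2007, §2.3 (text after eq. (2.48))] and the precise sense in which a non-zero `G_c^m`
on `m` sites witnesses correlations that do not split those sites into two independent groups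
[cite: ZhengEtAl2026, App. F.4]; it strictly extends `connCorr_eq_zero_of_prod` (full
factorisation). Proof: cluster relation at an anchor `a ∈ S ∩ A` (`moment_eq_sum_connCorr_of_mem`),
induction for the blocks `T ∌ S` that leave `A`, and the cluster relation of `S ∩ A` for the blocks
inside `A`. -/
theorem connCorr_eq_zero_of_indep (μ : Finset ι → ℝ) (hμ : μ ∅ = 1) (A : Finset ι) :
    ∀ S : Finset ι, (∀ T ⊆ S, μ T = μ (T ∩ A) * μ (T \ A)) →
      (S ∩ A).Nonempty → (S \ A).Nonempty → connCorr μ S = 0 := by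
  intro S
  induction S using Finset.strongInduction with
  | H S ih =>
  intro hfac hA hB
  obtain ⟨a, haSA⟩ := hA
  have ha : a ∈ S := (mem_inter.mp haSA).1
  have haA : a ∈ A := (mem_inter.mp haSA).2
  have hclu := moment_eq_sum_connCorr_of_mem μ hμ ha
  -- split the cluster sum at anchor `a` according to `T ⊆ A`
  rw [← sum_filter_add_sum_filter_not (S.powerset.filter fun T => a ∈ T) (fun T => T ⊆ A),
    filter_filter, filter_filter] at hclu
  -- (1) blocks inside `A`: the cluster relation of `S ∩ A` times `μ (S \ A)`, i.e. `μ S`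
  have h1 : ∑ T ∈ S.powerset.filter (fun T => a ∈ T ∧ T ⊆ A), connCorr μ T * μ (S \ T)
      = μ S := by
    have hidx : S.powerset.filter (fun T => a ∈ T ∧ T ⊆ A)
        = (S ∩ A).powerset.filter (fun T => a ∈ T) := by
      ext T
      simp only [mem_filter, mem_powerset, subset_inter_iff]
      tauto
    rw [hidx, hfac S subset_rfl, moment_eq_sum_connCorr_of_mem μ hμ haSA, sum_mul]
    refine sum_congr rfl fun T hT => ?_
    rw [mem_filter, mem_powerset, subset_inter_iff] at hT
    obtain ⟨⟨-, hTA⟩, -⟩ := hT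
    have e1 : (S \ T) ∩ A = (S ∩ A) \ T := by
      ext x
      simp only [mem_inter, mem_sdiff]
      tauto
    have e2 : (S \ T) \ A = S \ A := by
      ext x
      simp only [mem_sdiff]
      exact ⟨fun h => ⟨h.1.1, h.2⟩, fun h => ⟨⟨h.1, fun hxT => h.2 (hTA hxT)⟩, h.2⟩⟩
    rw [hfac (S \ T) sdiff_subset, e1, e2, mul_assoc]
  -- (2) blocks leaving `A`: only `T = S` survives (induction hypothesis on `T ⊊ S`)
  have h2 : ∑ T ∈ S.powerset.filter (fun T => a ∈ T ∧ ¬ T ⊆ A), connCorr μ T * μ (S \ T)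
      = connCorr μ S := by
    have hS : S ∈ S.powerset.filter (fun T => a ∈ T ∧ ¬ T ⊆ A) := by
      rw [mem_filter, mem_powerset]
      refine ⟨subset_rfl, ha, fun hSA => ?_⟩
      obtain ⟨x, hx⟩ := hB
      exact (mem_sdiff.mp hx).2 (hSA (mem_sdiff.mp hx).1)
    rw [sum_eq_single_of_mem S hS]
    · rw [sdiff_self, bot_eq_empty, hμ, mul_one]
    · intro T hT hTS
      rw [mem_filter, mem_powerset] at hT
      obtain ⟨hTsub, haT, hTA⟩ := hT
      have hss : T ⊂ S := Finset.ssubset_iff_subset_ne.mpr ⟨hTsub, hTS⟩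
      have hTA' : (T \ A).Nonempty := by
        by_contra h
        rw [not_nonempty_iff_eq_empty, sdiff_eq_empty_iff_subset] at h
        exact hTA h
      rw [ih T hss (fun T' hT' => hfac T' (hT'.trans hTsub)) ⟨a, mem_inter.mpr ⟨haT, haA⟩⟩ hTA',
        zero_mul]
  rw [h1, h2] at hclu
  calc connCorr μ S = (μ S + connCorr μ S) - μ S := by ring
    _ = 0 := by rw [← hclu, sub_self]

/-- `connCorr_eq_zero_of_indep` with the roles of `A` and its complement stated for a general
second group `B ⊇ S ∖ A`: independence between the `A`-sites and the `B`-sites of `S` kills the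
joint cumulant of `S` as soon as both are inhabited. [cite: Kardar2007, §2.3 (text after eq. (2.48))] -/
theorem connCorr_eq_zero_of_indep' (μ : Finset ι → ℝ) (hμ : μ ∅ = 1) {S A : Finset ι}
    (hfac : ∀ T ⊆ S, μ T = μ (T ∩ A) * μ (T \ A)) {a b : ι} (ha : a ∈ S) (haA : a ∈ A)
    (hb : b ∈ S) (hbA : b ∉ A) : connCorr μ S = 0 :=
  connCorr_eq_zero_of_indep μ hμ A S hfac ⟨a, mem_inter.mpr ⟨ha, haA⟩⟩ ⟨b, mem_sdiff.mpr ⟨hb, hbA⟩⟩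

/-! ### Moment functions of observables on a finite weighted sample space -/

end Literature.Probability.Moments

namespace Literature.Probability.Moments

variable {κ : Type*}

/-- The moment function `T ↦ Σ_ω w(ω) · ∏_{i∈T} n_i(ω)` of real observables `n_i` under weights
`w` on a finite sample space (for occupation numbers read off microscope samples, `w` = empirical or
Born weights). [cite: ZhengEtAl2026, App. F.4 (joint expectation ⟨n_1 ⋯ n_m⟩)] -/
def moment {Ω : Type*} [Fintype Ω] (w : Ω → ℝ) (n : κ → Ω → ℝ) (T : Finset κ) : ℝ :=
  ∑ ω, w ω * ∏ i ∈ T, n i ω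

/-- Moments of the empty set: total weight. [folklore] -/
theorem moment_empty {Ω : Type*} [Fintype Ω] (w : Ω → ℝ) (n : κ → Ω → ℝ) :
    moment w n ∅ = ∑ ω, w ω := by
  simp [moment]

/-- **Product states have factorising moments.** On a product sample space `Π i, Ω i` with a
product weight `w(ω) = ∏_i p_i(ω_i)` of unit mass in each factor, single-site observables
`n_i(ω) = f_i(ω_i)` have `μ(T) = ∏_{i∈T} (Σ_x p_i(x) f_i(x))`. Together with
`connCorr_eq_zero_of_prod`: all connected correlations of order `≥ 2` of a product state vanish.
[cite: Kardar2007, §2.3 (text after eq. (2.48))] -/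
theorem moment_prod_indep [Fintype κ] [DecidableEq κ] {Ω : κ → Type*} [∀ i, Fintype (Ω i)]
    (p : ∀ i, Ω i → ℝ) (hp : ∀ i, ∑ x, p i x = 1) (f : ∀ i, Ω i → ℝ) (T : Finset κ) :
    moment (fun ω : (∀ i, Ω i) => ∏ i, p i (ω i)) (fun i ω => f i (ω i)) T
      = ∏ i ∈ T, ∑ x, p i x * f i x := by
  unfold moment
  -- rewrite the integrand as a product over ALL sites of site-local factors
  have hint : ∀ ω : (∀ i, Ω i), (∏ i, p i (ω i)) * ∏ i ∈ T, f i (ω i)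
      = ∏ i, (if i ∈ T then p i (ω i) * f i (ω i) else p i (ω i)) := by
    intro ω
    rw [prod_ite, filter_mem_eq_inter, univ_inter, prod_mul_distrib]
    have hc : (univ.filter fun i => i ∉ T) = Tᶜ := by ext i; simp
    rw [hc, mul_assoc, mul_comm (∏ i ∈ T, f i (ω i)), ← mul_assoc, prod_mul_prod_compl]
  simp_rw [hint]
  have key : (∏ i, ∑ y, (if i ∈ T then p i y * f i y else p i y))
      = ∑ x : (∀ i, Ω i), ∏ i, (if i ∈ T then p i (x i) * f i (x i) else p i (x i)) := by
    rw [Finset.prod_univ_sum]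
    simp only [Fintype.piFinset_univ]
  rw [← key, ← prod_mul_prod_compl T]
  have h2 : ∏ i ∈ Tᶜ, ∑ y, (if i ∈ T then p i y * f i y else p i y) = 1 := by
    refine prod_eq_one fun i hi => ?_
    rw [mem_compl] at hi
    simp [hi, hp i]
  rw [h2, mul_one]
  exact prod_congr rfl fun i hi => by simp [hi]


/-! ### Indicator (click) observables -/

open scoped Classical in
/-- For `{0,1}`-valued observables (threshold-detector clicks, site parities, indicator events) the
moment of `T` is the total weight of the outcomes in which EVERY observable in `T` fires — the joint
click probability when `w` is a probability weight. Consequently the `connCorr (moment w n)` of click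
indicators are the connected correlation functions ("click cumulants") that serve as efficiently
computable benchmarks of boson-sampling devices [cite: HangleiterEisert2023, section
“Verification” (efficiently computable benchmarks: two-point and higher correlation functions, the
click-number distribution) and section “Experimental implementations” (Jiuzhang 2.0: first and
second order cumulants)]. The identity itself is [folklore]. -/
theorem moment_eq_sum_filter_of_indicator {Ω : Type*} [Fintype Ω] (w : Ω → ℝ) (n : κ → Ω → ℝ)
    (hn : ∀ i ω, n i ω = 0 ∨ n i ω = 1) (T : Finset κ) :
    moment w n T = ∑ ω ∈ Finset.univ.filter (fun ω => ∀ i ∈ T, n i ω = 1), w ω := by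
  rw [moment, sum_filter]
  refine sum_congr rfl fun ω _ => ?_
  by_cases h : ∀ i ∈ T, n i ω = 1
  · rw [if_pos h, prod_eq_one (fun i hi => h i hi), mul_one]
  · rw [if_neg h]
    push Not at h
    obtain ⟨i, hi, hne⟩ := h
    have h0 : n i ω = 0 := (hn i ω).resolve_right hne
    rw [prod_eq_zero hi h0, mul_zero]

open scoped Classical in
/-- The connected two-point function of two click indicators is the click covariance
`P(i and j fire) − P(i fires) · P(j fires)`. [cite: HangleiterEisert2023, section “Verification”
(two-point correlation functions as benchmarks)] [folklore] -/
theorem connCorr_pair_indicator [LinearOrder κ] {Ω : Type*} [Fintype Ω] (w : Ω → ℝ)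
    (n : κ → Ω → ℝ) (hn : ∀ i ω, n i ω = 0 ∨ n i ω = 1) {i j : κ} (hij : i ≠ j) :
    connCorr (moment w n) {i, j}
      = (∑ ω ∈ Finset.univ.filter (fun ω => n i ω = 1 ∧ n j ω = 1), w ω)
        - (∑ ω ∈ Finset.univ.filter (fun ω => n i ω = 1), w ω)
          * ∑ ω ∈ Finset.univ.filter (fun ω => n j ω = 1), w ω := by
  rw [connCorr_pair _ hij, moment_eq_sum_filter_of_indicator w n hn,
    moment_eq_sum_filter_of_indicator w n hn, moment_eq_sum_filter_of_indicator w n hn]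
  have e1 : Finset.univ.filter (fun ω => ∀ k ∈ ({i, j} : Finset κ), n k ω = 1)
      = Finset.univ.filter (fun ω => n i ω = 1 ∧ n j ω = 1) :=
    filter_congr fun ω _ => by simp only [mem_insert, mem_singleton, forall_eq_or_imp, forall_eq]
  have e2 : ∀ k : κ, Finset.univ.filter (fun ω => ∀ l ∈ ({k} : Finset κ), n l ω = 1)
      = Finset.univ.filter (fun ω => n k ω = 1) :=
    fun k => filter_congr fun ω _ => by simp only [mem_singleton, forall_eq]
  rw [e1, e2, e2]

end Literature.Probability.Moments

end
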